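import Summits.ResolutionOfSingularities.ResolutionOfSingularities.Theorems.ExtinctionCutPort
import HarnessLib

/-!
# WallCutClasses — decomp-res node «WallCut» (lens-3 g21, critic row 158), tree file 4/5 of the node

Content VERBATIM from the decomp-res lens-3 g21 node `HOME/decomp-res-lens-3/g21/WallCut.lean` (pin 1e528a76 =
`parts/…` of HOME/decomp-res-lens-3/g21, 2 135 l; HOME = run/shared/lean/pub/decomp-res; lens imports = tree
`MaxContactCutFreezeCut` +
`StallVertexStraightClasses` only; rc 0 · 0 sorry): its NEW PART ONLY, §W1–§W4 (l. 1330–2120) — the carried block l.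
65–1328 (= g20
`ExtinctionCut` c917c20b l. 48–1308, code VERBATIM) is ALREADY in the tree as `FreezeCutDead` · `FreezeCutDead2` ·
`FreezeCutDeadClasses` ·
`MaxContactCutFreezeCutDead` · `ExtinctionCutToric` · `ExtinctionCutToric2` · `ExtinctionCutPort` ·
`MaxContactCutExtinctionCut` and is imported, not
repeated.  Critic: CRITIC-LEDGER row 158 (2026-08-31T00:37:25Z): 0 · 0 — BOOKED with CONVERSION RESERVED («true
kernel content, land as support»:
THE WALL LAW pins the multiplicities, THE POLLUTION LAW kills the cleaning deficiency, the closing step is the ONE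
port at generality δ).  Landing
orders INBOX :569 (lens-3 g21 landing note) and :577 (critic): `--kind proof --supports stmt-ResolutionOfSingularities-31770`
(`MaxContactCut.DefectWalksDeep`); files of the node, in import order: `WallLaw` / `WallLaw2` (§W1, kernel,
namespace `…Theorems.WallCut`, over the
in-cone `FreezeCutDead2` + the toric kernel `ExtinctionCutToric2`) · `PollutionLaw` (§W2, model level, cone-free) ·
`WallCutClasses` (§W3 the ONE typed
port `BalancedWallPort` with `kollarWallPort_of_balancedWallPort`, and the three §W4 classes; cone-free so that the
route file can cite the port as an
item) · `MaxContactCutWallCut` (§W4 kernels and EXACT iff's at 31770, Theses cone; §M `closes` = tree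
`MaxContactCutExponentLadder.closes` verbatim is
omitted, as in `MaxContactCutFreezeCut`).  Aside bookkeeping (rows 156 / 158, INBOX :552 / :577): on the lens-3
column ONE typed PORT item
`WallCut.BalancedWallPort` (g20's `ExtinctionCut.KollarWallPort` is DERIVED from it) and ONE live aside
`FreezeCut.NoSmallDeadStrictHighSkewJointTailsDeep`
(home `FreezeCutDeadClasses`; mod-port reading LOSSY ∧ WILD-BALANCED, `smallDeadStrict_iff_lossy_wild_of_port`);
decided-mod-port cells are not filed.

## This file

§W3 THE ONE EQUIV (TYPED PORT, (M+)) + the §W4 classes (cone-free; namespace `…Theorems.WallCut`):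
**`BalancedWallPort`** — g20's `ExtinctionCut.KollarWallPort` with ONE hypothesis generalised (boundary balance
`perm(0, s−1, s−1)` ↦ δ-balance `perm(0, δ, δ)`, `δ = p^e − s`, on any sub-critical cell, with `¬ p ∣ s` explicit —
the TAME case) and NOTHING else changed; `kollarWallPort_of_balancedWallPort` (g20's port is the special case `δ = s
− 1`: the lens-3 column keeps ONE EQUIV); the §W3 module docstring carries the δ-dictionary line by line and the
port obligations.  §W4 classes, binders of `FreezeCut.NoSmallDeadStrictHighSkewJointTailsDeep` VERBATIM plus ONE
extra binder each: `NoLossyStrictTailsDeep` (total losses recur), `NoTameBalancedStrictTailsDeep` (`¬ p ∣ s`; EMPTY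
modulo the port), `NoWildBalancedStrictTailsDeep` (`p ∣ s`; the WILD residual).  A `def … : Prop` used as a
hypothesis — the ONE typed PORT item of the lens-3 column.  Imports `ExtinctionCutPort` (hence
`FreezeCutDeadClasses`): ONE route import covers port and live aside.

[WRITER NOTE (decomp-res writer g9): file split only (tree files ≤ 400 lines); namespaces, sections, section
variables and every declaration
exactly as in the lens (the lens's global opens are replayed per file; cone-free files carry the opens of
`FreezeCutClasses.lean`).]

(Sources: Kollar2007 (Lectures on Resolution of Singularities: Thm 1.93, Def 2.56, Rem 2.57, Claim 2.59.1, (2.59.2),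
Claim 2.59.4) [corpus:book:kollar2007-lectures-resolution-singularities pp. 54, 92–94]; ZariskiSamuel1960 vol. II
ch. VII §1 Thm 5; CossartJannsenSaito2009 (arXiv:0905.2191 §2); Hauser2010Kangaroo (arXiv:0811.4151); Moh1987;
CossartPiltant2008 §2.)
-/

noncomputable section

open MvPolynomial Finset
open Literature.AlgebraicGeometry.Resolution
open Literature.AlgebraicGeometry.Resolution.Hauser2010
open Literature.AlgebraicGeometry.Resolution.PointBlowup
open Literature.AlgebraicGeometry.Resolution.WeightedBlowup
open Summit.ResolutionOfSingularities.ResolutionOfSingularities.Theorems.TightDefectClasses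
open Summit.ResolutionOfSingularities.ResolutionOfSingularities.Theorems.ProximityCut
open Summit.ResolutionOfSingularities.ResolutionOfSingularities.Theorems.TightCut
open Summit.ResolutionOfSingularities.ResolutionOfSingularities.Theorems.HoleCut

namespace Summit.ResolutionOfSingularities.ResolutionOfSingularities.Theorems.WallCut

/-! ## §W3 THE ONE EQUIV — Kollár's coefficient-curve law on a δ-BALANCED TAME tail (TYPED PORT, (M+))

`BalancedWallPort` is the single translation this node allows itself.  It is g20's `ExtinctionCut.KollarWallPort`
with ONE hypothesis generalised and NOTHING else changed: the balance shape `r ∈ perm(0, s−1, s−1)` of the boundary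
line `p^e + 1 = 2s` becomes the δ-balance `r ∈ perm(0, δ, δ)`, `δ = p^e − s`, of an arbitrary sub-critical cell
`p^e + 1 ≤ 2s`, `s + 1 ≤ p^e`, and the arithmetic consequence `p ∤ s` of the boundary relation becomes the explicit
hypothesis `¬ p ∣ s` (the TAME case; `p ∣ s` is the WILD residual `NoWildBalancedStrictTailsDeep` of §W4).  g20's port
is the special case `δ = s − 1` (`kollarWallPort_of_balancedWallPort`), so the node still has ONE EQUIV, deciding
BOTH g20's boundary class and g21's tame balanced strict class.

DICTIONARY — g20's §2 dictionary VERBATIM with `n − 1 ↦ δ = q − s` (`q = p^e`, `n = s`), checked line by line: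
* WALLS.  `r_t ∈ perm(0, δ, δ)` (binder; by §W1 THE WALL LAW this is AUTOMATIC on every tail of the strict residual
  without total losses); `o_t = s + 2δ = 2q − s` (plateau + balance), `F_t = y^{r_t} G_t`, `ordZero G_t = s`.
  ARITHMETIC: `p ∤ s` is now a HYPOTHESIS (on the boundary it followed from `2s ≡ 1 (mod p)`); `p = 2` is allowed.
* REGULARITY (`G_t` is `y_Z`-regular of order `s` from `N + 1` on): g20's pencil-law argument uses only plateau,
  balance («the centre lies on exactly one old wall, the kept one») and the recurrence of repeats — unchanged.
* NORMAL FORM [Kollar2007 Thm 1.93 + Def 2.56/Rem 2.57]: Weierstrass in `w` of degree `s`, Tschirnhaus (`p ∤ s`),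
  `mult₀ a_i ≥ i`, shifted supports `S i t = {(A − i, B − i)}` — unchanged (`n = s`).  BOX unchanged.
* CENTRES TORUS-FIXED + LETTER SWITCH (K4) [Kollar2007 Claim 2.59.1 + balance]: unchanged; moreover the multiplicity
  shadow of K4 is now a THEOREM (§W1 `frame_succ`: a proximity repeat keeps the newest wall).
* TORIC LAW MOD ℕ² (K1a/K1b) [Kollar2007 (2.59.2), Claim 2.59.4 (v)]: in the chart `u' = u, v' = v/u, w' = w/u` the
  total transform is `u^{2δ+s} v'^{δ} · unit · P'`, `o − q = δ`, so the UNCLEANED model state is `u^{δ} v'^{δ} · unit · P'`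
  with `P' = w'^s + Σ u^{-i} a_i(u, uv') w'^{s-i}` (shifted exponents move by `U`, resp. `V`); the CLEANING subtracts `h`,
  the `q`-th-power part, and by §W2 THE POLLUTION LAW (`walk_pollution_balanced`, PROVED) every monomial of `h` has
  `u`- and `v'`-exponent `≥ δ + s = q`, i.e. `h / (u^δ v'^δ) ∈ I := (u^s v'^s) ⊂ K[[u, v']][w']` — the SAME ideal as on
  the boundary; Weierstrass re-preparation and Tschirnhaus modulo `I` leave the prepared data unchanged (uniqueness in
  1.93 over `K[[u,v']]/I`), and `I · w'^{s−i}` only meets shifted exponents `≥ (s − i, s − i) ≥ (0, 0)`.  Hence EXACTLY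
  `S i (t+1) ∖ ℕ² = U(S i t) ∖ ℕ²` (resp. `V`).
* EQUIMULTIPLICITY (K2) [Kollar2007 2.59.1]: unchanged.
* ISOLATION (K3) [`ForcedWalk.isolated`]: if every `S i t ⊆ ℕ²` then `P ∈ (v, w)^s = 𝔓^s` and
  `F = u^δ v^δ · unit · P ∈ 𝔓^{δ + s} = 𝔓^{q}` — the exponent identity `δ + s = q` replaces the boundary's
  `(n − 1) + n = q`; then `topIdeal q F ⊆ 𝔓` and `¬ IsolatedTop q F` as before.
PORT OBLIGATIONS for a prover typing it: exactly g20's list (Weierstrass 1.93 over `K[[u,v]]` and `K[[u,v]]/(uv)^s`;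
Hasse form of 2.59.1 for `p ∤ s`; pencil law; `hasseDeriv (𝔓^q) ⊆ 𝔓`; `F_t = y^{r_t} G_t` along `st_succ`) — the
pollution entry is now DISCHARGED by §W2.
[cite: Kollar2007, Thm 1.93, Def 2.56, Rem 2.57, Claim 2.59.1, (2.59.2), Claim 2.59.4 (v); ZariskiSamuel1960 vol. II
ch. VII §1 Thm 5; CossartJannsenSaito2009 = arXiv:0905.2191 §2] [corpus:book:kollar2007-lectures-resolution-singularities
pp. 54, 92–94] [KNOWN-MOD-PORT (M+) · the ONE EQUIV of this node] -/

/-- **THE PORT (ONE EQUIV).**  Kollár's coefficient-curve law [Kollar2007, 1.93, 2.56–2.57, 2.59.1, (2.59.2),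
2.59.4 (v)] read on a δ-balanced TAME (`p ∤ s`) sub-critical tail of a forced walk: beyond some stage `N₁ ≥ N` there
are a letter word `w` and shifted coefficient supports `S i t ⊆ ℤ²` (`i ≤ s`) with (K4) a proximity repeat switches the
letter, (BOX) stage-`N₁` supports in `[-i, ∞)²`, (K1a/K1b) outside `ℕ²` the supports move EXACTLY by the toric
substitution `ExtinctionCut.step (w t)`, (K2) `-i ≤ a + b` on every support point, (K3) at every stage some support
point lies outside `ℕ²`.  g20's `KollarWallPort` is its boundary case (`kollarWallPort_of_balancedWallPort`).
[KNOWN-MOD-PORT (M+)] (Sources: Kollar2007, Thm 1.93, Def 2.56, Rem 2.57, Claim 2.59.1, (2.59.2.x), Claim 2.59.4 (v).) -/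
def BalancedWallPort : Prop :=
  ∀ p : ℕ, p.Prime → ∀ e : ℕ, ∀ (K : Type) [Field K] [CharP K p] [PerfectField K] [DecidableEq K]
    (s₀ : State (Fin 3) K), IsRoot (p ^ e) s₀ → ∀ W : ForcedWalk (p ^ e) s₀,
    ∀ N : ℕ, (∀ t, N ≤ t → (W.st (t + 1)).shade = (W.st t).shade) →
    (∀ M : ℕ, ∃ t, M ≤ t ∧ StaysOnNewest W t) →
    ∀ s : ℕ, (W.st N).shade = (s : ℕ∞) → 2 ≤ s → s + 1 ≤ p ^ e → p ^ e + 1 ≤ 2 * s → ¬ p ∣ s →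
    (∀ t, N ≤ t → ((W.st t).r.degree + 2 * s = 2 * p ^ e ∧
      ∃ x, (W.st t).r x = 0 ∧ ∀ y, y ≠ x → (W.st t).r y + s = p ^ e)) →
    ∃ N₁ : ℕ, N ≤ N₁ ∧ ∃ (w : ℕ → Bool) (S : ℕ → ℕ → Set (ℤ × ℤ)),
      (∀ t, StaysOnNewest W (N₁ + t) → w (t + 1) ≠ w t) ∧
      (∀ i, i ≤ s → ∀ x ∈ S i 0, -(i : ℤ) ≤ x.1 ∧ -(i : ℤ) ≤ x.2) ∧
      (∀ i, i ≤ s → ∀ t, ∀ x ∈ S i t, ¬ ExtinctionCut.InQuad (ExtinctionCut.step (w t) x) →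
        ExtinctionCut.step (w t) x ∈ S i (t + 1)) ∧
      (∀ i, i ≤ s → ∀ t, ∀ y ∈ S i (t + 1), ¬ ExtinctionCut.InQuad y → ∃ x ∈ S i t, ExtinctionCut.step (w t) x = y) ∧
      (∀ i, i ≤ s → ∀ t, ∀ x ∈ S i t, -(i : ℤ) ≤ x.1 + x.2) ∧
      (∀ t, ∃ i, i ≤ s ∧ ∃ x ∈ S i t, ¬ ExtinctionCut.InQuad x)

/-- g20's boundary port is the case `δ = s − 1` of the balanced port: on the boundary line `p^e + 1 = 2s` one has
`p ∤ s` (`p ∣ 2s − 1`), `s + 1 ≤ p^e`, and `r ∈ perm(0, s−1, s−1)` is `r ∈ perm(0, δ, δ)`. [new] [folklore] -/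
theorem kollarWallPort_of_balancedWallPort (hπ : BalancedWallPort) : ExtinctionCut.KollarWallPort := by
  intro p hp e K _ _ _ _ s₀ hs W N hN hrec s hsN h2 hq hbal
  have hpq : p ∣ p ^ e := by
    rcases Nat.eq_zero_or_pos e with h0 | h0
    · subst h0; simp at hq; omega
    · exact dvd_pow_self p (by omega)
  have hndvd : ¬ p ∣ s := by
    intro hd
    have h2s : p ∣ p ^ e + 1 := by rw [hq]; exact dvd_mul_of_dvd_right hd 2
    have h1 : p ∣ 1 := (Nat.dvd_add_right hpq).mp h2s
    exact absurd (Nat.eq_one_of_dvd_one h1) hp.one_lt.ne'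
  refine hπ p hp e K s₀ hs W N hN hrec s hsN h2 (by omega) (by omega) hndvd fun t ht => ?_
  obtain ⟨hD, x, hx, hy⟩ := hbal t ht
  exact ⟨by omega, x, hx, fun y hyx => by have := hy y hyx; omega⟩

open Summit.ResolutionOfSingularities.ResolutionOfSingularities.Theorems.FreezeCut

section Classes

/-! ## §W4 THE SPLIT BENEATH — the strict residual ≡ LOSSY ∧ TAME-BALANCED ∧ WILD-BALANCED (exact, hypothesis-free,
by THE WALL LAW); TAME-BALANCED EMPTY modulo the ONE EQUIV; EXACT re-location of 31770 (KERNEL)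

All three classes carry the binders of `FreezeCut.NoSmallDeadStrictHighSkewJointTailsDeep` VERBATIM (deep `2 ≤ e`,
root, positive shades, plateau from `N`, positive excess, proximity repeats and translations beyond every bound, shade
`s ≥ 3`, `3s ≥ p^e + 3`, STRICT `p^e + 2 ≤ 2s`, skew, SMALL-DEAD from `N`) and ONE extra binder each. -/

/-- LOSSY strict tails: TOTAL-LOSS moves (after the move the newest wall is the only wall: every other coordinate has
multiplicity `0`) recur beyond every bound.  THE RESIDUAL this node hands on (SEED-g22: a total loss is a move whose
centre is off both walls; at a small-dead stage it leaves the single wall with mass in `[δ + 1, s − 1]`, a range that is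
EMPTY on the boundary line — which is why g19's D7 needed no such class). [new] -/
def NoLossyStrictTailsDeep : Prop :=
  ∀ p : ℕ, p.Prime → ∀ e : ℕ, 2 ≤ e → ∀ (K : Type) [Field K] [CharP K p] [PerfectField K] [DecidableEq K]
    (s₀ : State (Fin 3) K), IsRoot (p ^ e) s₀ → ∀ W : ForcedWalk (p ^ e) s₀, (∀ i, 1 ≤ (W.st i).shade) →
    ∀ N : ℕ, (∀ t, N ≤ t → (W.st (t + 1)).shade = (W.st t).shade) →
    (∀ t, N ≤ t → ordZero (W.st t).F ≠ ((p ^ e : ℕ) : ℕ∞)) → (∀ M : ℕ, ∃ t, M ≤ t ∧ StaysOnNewest W t) →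
    (∀ M : ℕ, ∃ t, M ≤ t ∧ W.b t ≠ 0) →
    ∀ s : ℕ, (W.st N).shade = (s : ℕ∞) → 3 ≤ s → p ^ e + 3 ≤ 3 * s → p ^ e + 2 ≤ 2 * s →
    (∀ (k : Fin 3) (N' : ℕ), ∃ t, N' ≤ t ∧ (W.j t = k ∨ W.b t k ≠ 0)) →
    (∀ t, N ≤ t → ((∀ y, (W.st t).r y + 1 ≤ s) ∧ ∃ x, (W.st t).r x = 0 ∧
      ∃ d ∈ (W.st t).F.support, ((d.degree : ℕ) : ℕ∞) = ordZero (W.st t).F ∧ (W.st t).r x < d x)) →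
    (∀ M : ℕ, ∃ t, M ≤ t ∧ ∀ y, y ≠ W.j t → (W.st (t + 1)).r y = 0) → False

/-- TAME δ-BALANCED strict tails (`p ∤ s`, every stage from `N` on has `|r| = 2δ` and `r ∈ perm(0, δ, δ)`,
`δ = p^e − s`).  DECIDED (EMPTY) modulo the ONE EQUIV (`noTameBalancedStrictTails_of_port`). [new] -/
def NoTameBalancedStrictTailsDeep : Prop :=
  ∀ p : ℕ, p.Prime → ∀ e : ℕ, 2 ≤ e → ∀ (K : Type) [Field K] [CharP K p] [PerfectField K] [DecidableEq K]
    (s₀ : State (Fin 3) K), IsRoot (p ^ e) s₀ → ∀ W : ForcedWalk (p ^ e) s₀, (∀ i, 1 ≤ (W.st i).shade) →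
    ∀ N : ℕ, (∀ t, N ≤ t → (W.st (t + 1)).shade = (W.st t).shade) →
    (∀ t, N ≤ t → ordZero (W.st t).F ≠ ((p ^ e : ℕ) : ℕ∞)) → (∀ M : ℕ, ∃ t, M ≤ t ∧ StaysOnNewest W t) →
    (∀ M : ℕ, ∃ t, M ≤ t ∧ W.b t ≠ 0) →
    ∀ s : ℕ, (W.st N).shade = (s : ℕ∞) → 3 ≤ s → p ^ e + 3 ≤ 3 * s → p ^ e + 2 ≤ 2 * s →
    (∀ (k : Fin 3) (N' : ℕ), ∃ t, N' ≤ t ∧ (W.j t = k ∨ W.b t k ≠ 0)) →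
    (∀ t, N ≤ t → ((∀ y, (W.st t).r y + 1 ≤ s) ∧ ∃ x, (W.st t).r x = 0 ∧
      ∃ d ∈ (W.st t).F.support, ((d.degree : ℕ) : ℕ∞) = ordZero (W.st t).F ∧ (W.st t).r x < d x)) →
    ¬ p ∣ s →
    (∀ t, N ≤ t → ((W.st t).r.degree + 2 * s = 2 * p ^ e ∧
      ∃ x, (W.st t).r x = 0 ∧ ∀ y, y ≠ x → (W.st t).r y + s = p ^ e)) → False

/-- WILD δ-BALANCED strict tails (`p ∣ s`): the residual where Kollár's maximal contact (Tschirnhaus, Claim 2.59.1)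
is unavailable [Kollar2007 Rem 2.57, 2.59.2–2.59.4 in char `p`] — the wild-multiplicity surface problem read on two
walls.  Inhabited entrance in the universe census: `(p^e, s) = (8, 6)`, `r = (2, 0, 2)` (H:1489/1490). [new] -/
def NoWildBalancedStrictTailsDeep : Prop :=
  ∀ p : ℕ, p.Prime → ∀ e : ℕ, 2 ≤ e → ∀ (K : Type) [Field K] [CharP K p] [PerfectField K] [DecidableEq K]
    (s₀ : State (Fin 3) K), IsRoot (p ^ e) s₀ → ∀ W : ForcedWalk (p ^ e) s₀, (∀ i, 1 ≤ (W.st i).shade) →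
    ∀ N : ℕ, (∀ t, N ≤ t → (W.st (t + 1)).shade = (W.st t).shade) →
    (∀ t, N ≤ t → ordZero (W.st t).F ≠ ((p ^ e : ℕ) : ℕ∞)) → (∀ M : ℕ, ∃ t, M ≤ t ∧ StaysOnNewest W t) →
    (∀ M : ℕ, ∃ t, M ≤ t ∧ W.b t ≠ 0) →
    ∀ s : ℕ, (W.st N).shade = (s : ℕ∞) → 3 ≤ s → p ^ e + 3 ≤ 3 * s → p ^ e + 2 ≤ 2 * s →
    (∀ (k : Fin 3) (N' : ℕ), ∃ t, N' ≤ t ∧ (W.j t = k ∨ W.b t k ≠ 0)) →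
    (∀ t, N ≤ t → ((∀ y, (W.st t).r y + 1 ≤ s) ∧ ∃ x, (W.st t).r x = 0 ∧
      ∃ d ∈ (W.st t).F.support, ((d.degree : ℕ) : ℕ∞) = ordZero (W.st t).F ∧ (W.st t).r x < d x)) →
    p ∣ s →
    (∀ t, N ≤ t → ((W.st t).r.degree + 2 * s = 2 * p ^ e ∧
      ∃ x, (W.st t).r x = 0 ∧ ∀ y, y ≠ x → (W.st t).r y + s = p ^ e)) → False

end Classes

end Summit.ResolutionOfSingularities.ResolutionOfSingularities.Theorems.WallCut
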